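import Summits.AtomisticToContinuum.BoseEinsteinCondensation.Theorems.GaussianDominationCan.Negative.LoadBearing
import Summits.AtomisticToContinuum.BoseEinsteinCondensation.Theorems.GaussianDominationCan.Negative.FreeConstant
import Summits.AtomisticToContinuum.BoseEinsteinCondensation.Theorems.GaussianDominationCan.Negative.StructureII

/-!
# Disproof of `GaussianDominationCan` — findings (crux `stmt-AtomisticToContinuum-9479`, route BECThomsonPrinciple)

Standing crux-disprover work file (gen1 → gen2 → gen3).  VERDICT SO FAR: **no kill**.  The crux is the
finite-`k`, `T = 0` phase-stiffness (Gaussian-domination) inequality for the Lewin–Nam–Serfaty–Solovej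
excitation source `Λ_k† = a_k† a_0 n̂₀^{-1/2}` of the dilute periodic Bose gas:
`|⟨Φ, Λ_k†Φ⟩|² ≤ 4π²C k∞⁻² (E_v(Φ) − E₀)` for every Bose trial state (square form of the chord,
`forall_gdIneq_iff`), uniformly in `N ≥ N₀`, `ρ = N/L³ ≤ ρ₀(v,M)`, `2π/L ≤ k∞ ≤ M√ρ`.  It is OPEN and
expected TRUE; every regime we can compute saturates or respects it (list below).

The conclusive content of gen1/gen2 LANDED as ordinary theorems under
`Theorems/GaussianDominationCan/Negative/` (imported here; the gen2 evidence file itself is not mounted in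
seat jails, so THIS file re-indexes it by name and extends it):

* `CruxForms`      — `gaussianDominationCan_iff` (crux = `∀ v M, ∃ ρ₀ C N₀, GDCanWith ρ₀ C N₀ v M`, `Iff.rfl`);
  `forall_gdIneq_iff` (chord ⇔ square/susceptibility form); `corner` (the ultra-dilute TOP CORNER of the
  admissible region `L = M²N/4π²`, `n = e₀`, `k∞ = M√ρ`: this is Gross–Pitaevskii scaling `Na/L = 4π²a/M²`);
  `gaussianDominationCan_iff_bare` (guards `0<M`, `0<L`, `0≤s` are decoration).
* `LoadBearing`    — `gaussianDominationCan_iff_noN₀` (`N₀` is NOT load-bearing: the window forces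
  `4π²L ≤ M²N`, so shrinking `ρ₀` excludes small `N`; ANY DISPROOF MUST WORK AT ARBITRARILY LARGE `N`);
  `gaussianDominationCan_false_without_n_ne_zero` (`n ≠ 0` IS load-bearing);
  `gaussianDominationCan_false_without_symm` (Bose symmetry IS load-bearing: the factor `2(m+1)` on particle
  `0` is calibrated to symmetric states; `φ ⊗ c^{⊗(N-1)}` has susceptibility `∼ N`).
* `FreeConstant`   — `free_const_ge` (for `v = 0` every admissible constant has `C ≥ 1/(4π²)`: coherent
  two-mode product states at the top corner) and `not_gaussianDominationCan_sharp` (`C < 1/4π²` is FALSE).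
* `ProductCalculus`/`ProductStates`/`ProductStatesConst` — exact evaluation of the crux's own `foldr`
  operators `P_i`, `Q_S`, `Θ`, the source integral and the energy on product states.
* `Structure`/`StructureII` — `{P_i}` is a commuting family of self-adjoint idempotents on continuous
  periodic functions, `P_i(1−P_i) = 0`, `Θ` is `x₀`-independent (steps P1–P3 of the free-gas blueprint).

## gen3 additions (this file)

* §A  index aliases of the landed results (one-stop reading for ideators / planners / the lead).
* §B  NEW, PROVED: `not_gaussianDominationCanSuperquadratic` — the penalty SHAPE is load-bearing on the
      small-`s` side: with `C s^p L²/‖n‖²`, ANY `p > 2` (even `p`, `C`, `ρ₀` chosen after `v`, `M`), the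
      statement is false for the free gas (top corner, `s = 3π²/L² → 0`: the susceptibility is finite and
      non-zero, so the response is genuinely quadratic).  Read with `free_const_ge`: at `p = 2` the constant
      is pinned to `≥ 1/4π²`; for `p < 2` the budget dominates at the corner (no information).
* §C  NEAR-MISSES (sorried, conjectural, with the obstruction): the density threshold `ρ₀ → 0` is
      load-bearing in substance (`conjecture_gdCan_false_at_fixed_density`): at FIXED density the statement
      fails for crystallising admissible `v` (hard spheres near freezing, cluster-crystal soft cores) through
      the Anderson tower of states — so any proof must use diluteness beyond `kR₀ ≪ 1`.
* §D  TARGETS: the registered stubs of the three lines (`Lines/ward-chord-splitting.lean` = the skeleton;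
      `coupling-monotone-chord`, `raman-chord-regimes`) read against everything here — none is refuted;
      which are theorems, which are crux-strength, and where each would break (comments, per stub).
* §E  KILL RECORD (why it resists), regimes and numbers — docblock at the end; ED toy j011503/j0115xx.

All theorems here are [folklore]-level elementary witnesses; axioms ⊆ {propext, Classical.choice, Quot.sound}.
-/

noncomputable section

namespace Summit.AtomisticToContinuum.BoseEinsteinCondensation.Cruxes.GaussianDominationCan.Disproof

open MeasureTheory Literature.MathematicalPhysics.QuantumManyBody.BoseGas
open Summit.AtomisticToContinuum.BoseEinsteinCondensation.Theorems.GaussianDominationCan.Negative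
open scoped ENNReal NNReal ComplexConjugate

variable {L : ℝ}

/-! ## §A Index of the landed disprover results (aliases; see the files for docstrings) -/

section Index

/-- The crux in named vocabulary (`Iff.rfl`). -/
alias crux_iff := gaussianDominationCan_iff
/-- Chord ⇔ square (susceptibility) form at one trial state. -/
alias crux_chord_iff_square := forall_gdIneq_iff
/-- `N₀` is not load-bearing. -/
alias crux_iff_noN₀ := gaussianDominationCan_iff_noN₀
/-- The three guards are decoration. -/
alias crux_iff_bare := gaussianDominationCan_iff_bare
/-- Any proof must use `n ≠ 0`. -/
alias crux_false_without_n_ne_zero := gaussianDominationCan_false_without_n_ne_zero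
/-- Any proof must use Bose symmetry of the trial class. -/
alias crux_false_without_symm := gaussianDominationCan_false_without_symm
/-- `C ≥ 1/(4π²)` is forced by the free gas. -/
alias crux_free_const_ge := free_const_ge
/-- `C < 1/(4π²)` is refuted. -/
alias crux_not_sharp := not_gaussianDominationCan_sharp
/-- The admissible region is non-empty: its top corner. -/
alias crux_corner := corner

end Index

/-! ## §B The penalty shape: a super-quadratic budget `C s^p L²/‖n‖²`, `p > 2`, is FALSE -/

section Superquadratic

/-- The crux inequality with a general real power `p` of `s` in the penalty (`s ^ p` is `Real.rpow`). -/
def GDIneqPow (v : ℝ → ℝ≥0∞) (m : ℕ) (L : ℝ) (n : Fin 3 → ℤ) (C p s : ℝ)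
    (Φ : PeriodicTrialState (m + 1) L) : Prop :=
  periodicGroundStateEnergy v (m + 1) L +
      ENNReal.ofReal (s * (2 * (m + 1) * ‖sourceIntegral m L n Φ.ψ‖)) ≤
    periodicEnergy v Φ + ENNReal.ofReal (C * s ^ p * L ^ 2 / ‖(fun j => (n j : ℝ))‖ ^ 2)

/-- At `p = 2` this is the crux inequality verbatim. -/
theorem gdIneqPow_two (v : ℝ → ℝ≥0∞) (m : ℕ) (L : ℝ) (n : Fin 3 → ℤ) (C s : ℝ)
    (Φ : PeriodicTrialState (m + 1) L) : GDIneqPow v m L n C 2 s Φ ↔ GDIneq v m L n C s Φ := by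
  unfold GDIneqPow GDIneq
  rw [Real.rpow_two]

/-- The crux with penalty exponent `p > 2` (the defender may still choose `ρ₀, C, p, N₀` after `v, M`). -/
def GaussianDominationCanSuperquadratic : Prop :=
  ∀ v : ℝ → ℝ≥0∞, IsRepulsiveFiniteRange v → ∀ M : ℝ, 0 < M →
    ∃ ρ₀ C p : ℝ, 0 < ρ₀ ∧ 0 < C ∧ 2 < p ∧ ∃ N₀ : ℕ,
      ∀ m : ℕ, N₀ ≤ m + 1 → ∀ L : ℝ, 0 < L → ((m + 1 : ℕ) : ℝ) ≤ ρ₀ * L ^ 3 →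
        ∀ n : Fin 3 → ℤ, n ≠ 0 → InWindow M m L n → ∀ s : ℝ, 0 ≤ s →
          ∀ Φ : PeriodicTrialState (m + 1) L, GDIneqPow v m L n C p s Φ

/-- Reading a finite-energy `ℝ≥0∞` inequality `E₀ + x ≤ E + y` as the real inequality `x ≤ E + y`
(dropping `E₀ ≥ 0`). -/
theorem real_of_le_budget {E₀ : ℝ≥0∞} {x E y : ℝ} (hE : 0 ≤ E) (hy : 0 ≤ y)
    (h : E₀ + ENNReal.ofReal x ≤ ENNReal.ofReal E + ENNReal.ofReal y) : x ≤ E + y := by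
  rw [← ENNReal.ofReal_add hE hy] at h
  exact (ENNReal.ofReal_le_ofReal_iff (add_nonneg hE hy)).mp (le_add_self.trans h)

set_option maxHeartbeats 1600000 in
/-- **The `s²` shape of the penalty is sharp on the small-`s` side**: with budget `C s^p L²/‖n‖²` and ANY
`p > 2` the statement is false already for the free gas `v = 0` (window `M = 1`).  Witness: the top corner
`L = N/4π²`, `n = e₀`, the coherent two-mode product state `((α + βe_{e₀})/√L³)^{⊗N}` with `β²L³ = 1/(4N)`
(source `u ≥ 1/(2√2)`, energy `π²/L²`), and `s = 3π²/L²`: the needed budget is `≍ s²L² = 9π⁴/L²` while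
`C s^p L² = C(3π²)^p L^{2-2p} = o(L⁻²)`.  (So at the corner only `s = O(k²) = O(L⁻²)` matters and the response
there is genuinely quadratic: finite non-zero susceptibility.) [folklore] -/
theorem not_gaussianDominationCanSuperquadratic : ¬ GaussianDominationCanSuperquadratic := by
  intro h
  obtain ⟨ρ₀, C, p, hρ, hC, hp, N₀, hG⟩ := h 0 isRepulsiveFiniteRange_zero 1 one_pos
  -- exponent bookkeeping: q = 2p - 4 > 0, K = C (3π²)^p / π², Lmin^q = K + 1
  set q : ℝ := 2 * p - 4 with hqdef
  have hq : 0 < q := by rw [hqdef]; linarith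
  set K : ℝ := C * (3 * Real.pi ^ 2) ^ p / Real.pi ^ 2 with hKdef
  have hK : 0 < K := by positivity
  set Lmin : ℝ := (K + 1) ^ q⁻¹ with hLmindef
  have hLmin : 0 ≤ Lmin := by positivity
  -- choice of N (large) and L = N/4π² (top corner, M = 1)
  obtain ⟨m, hmN₀, hmT⟩ :=
    exists_large N₀ (64 * Real.pi ^ 6 / (ρ₀ * 1 ^ 6) + 4 * Real.pi ^ 2 * (1 + Lmin))
  set N : ℝ := ((m + 1 : ℕ) : ℝ) with hNdef
  have hN1 : (1 : ℝ) ≤ N := by rw [hNdef]; exact_mod_cast Nat.succ_le_succ (Nat.zero_le m)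
  have hNpos : 0 < N := by linarith
  have hKN : 64 * Real.pi ^ 6 / (ρ₀ * 1 ^ 6) ≤ N := by
    have : 0 ≤ 4 * Real.pi ^ 2 * (1 + Lmin) := by positivity
    linarith
  obtain ⟨hL, hdens, hwin⟩ := corner one_pos hρ m hKN
  set L : ℝ := 1 ^ 2 * N / (4 * Real.pi ^ 2) with hLdef
  have hL1 : 1 + Lmin ≤ L := by
    rw [hLdef, le_div_iff₀ (by positivity)]
    have e : (1 : ℝ) ^ 2 * N = N := by ring
    have : 0 ≤ 64 * Real.pi ^ 6 / (ρ₀ * 1 ^ 6) := by positivity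
    rw [e]
    linarith
  have hLge1 : 1 ≤ L := by linarith
  have hLmin_le : Lmin ≤ L := by linarith
  have hLq : K + 1 ≤ L ^ q := by
    have h1 : Lmin ^ q = K + 1 := by
      rw [hLmindef, Real.rpow_inv_rpow (by positivity) hq.ne']
    rw [← h1]
    exact Real.rpow_le_rpow hLmin hLmin_le hq.le
  -- amplitudes: B = β²L³ = 1/(4N), A = 1 - B
  set B : ℝ := 1 / (4 * N) with hBdef
  set A : ℝ := 1 - B with hAdef
  have hB : 0 < B := by positivity
  have hB1 : B ≤ 1 / 4 := by
    rw [hBdef, div_le_div_iff₀ (by positivity) (by positivity)]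
    nlinarith
  have hA : 0 < A := by rw [hAdef]; linarith
  set a : ℝ := Real.sqrt (A / L ^ 3) with hadef
  set b : ℝ := Real.sqrt (B / L ^ 3) with hbdef
  have ha : 0 ≤ a := Real.sqrt_nonneg _
  have hb : 0 ≤ b := Real.sqrt_nonneg _
  have ha2 : a ^ 2 * L ^ 3 = A := by
    rw [hadef, Real.sq_sqrt (by positivity), div_mul_cancel₀ _ (by positivity)]
  have hb2 : b ^ 2 * L ^ 3 = B := by
    rw [hbdef, Real.sq_sqrt (by positivity), div_mul_cancel₀ _ (by positivity)]
  have hab : (a ^ 2 + b ^ 2) * L ^ 3 = 1 := by rw [add_mul, ha2, hb2, hAdef]; ring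
  have hN' : (m : ℝ) + 1 = N := by rw [hNdef]; push_cast; ring
  -- the source lower bound u and its square
  have hsrc := norm_sourceIntegral_symFun_ge (m := m) hL e0_ne_zero ha hb
  rw [show L ^ 3 * a ^ 2 = A by rw [← ha2]; ring, hN'] at hsrc
  set P : ℝ := L ^ 3 * a * b with hPdef
  have hP2 : P ^ 2 = A * B := by
    calc P ^ 2 = (a ^ 2 * L ^ 3) * (b ^ 2 * L ^ 3) := by rw [hPdef]; ring
      _ = A * B := by rw [ha2, hb2]
  have hP : 0 ≤ P := by positivity
  set u : ℝ := N * ((Real.sqrt N)⁻¹ * P * A ^ m) with hudef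
  have hu : 0 ≤ u := by positivity
  have hu2 : u ^ 2 = N * (A * B) * A ^ (2 * m) := by
    have h1 : (Real.sqrt N)⁻¹ ^ 2 = N⁻¹ := by rw [inv_pow, Real.sq_sqrt hNpos.le]
    calc u ^ 2 = N ^ 2 * (Real.sqrt N)⁻¹ ^ 2 * P ^ 2 * (A ^ m) ^ 2 := by rw [hudef]; ring
      _ = N ^ 2 * N⁻¹ * (A * B) * A ^ (2 * m) := by rw [h1, hP2, ← pow_mul, mul_comm m 2]
      _ = N * (A * B) * A ^ (2 * m) := by field_simp
  have hNB : N * B = 1 / 4 := by rw [hBdef]; field_simp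
  have hbern : 1 - ((2 * m + 1 : ℕ) : ℝ) * B ≤ A ^ (2 * m + 1) := by
    have hh := one_add_mul_le_pow (show (-2 : ℝ) ≤ -B by linarith) (2 * m + 1)
    have e : (1 : ℝ) + -B = A := by rw [hAdef]; ring
    rw [e] at hh
    linarith [hh]
  have hcast : ((2 * m + 1 : ℕ) : ℝ) = 2 * N - 1 := by rw [hNdef]; push_cast; ring
  have hsmall : ((2 * m + 1 : ℕ) : ℝ) * B ≤ 1 / 2 := by
    rw [hcast, hBdef, mul_one_div, div_le_div_iff₀ (by positivity) (by positivity)]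
    nlinarith [hN1]
  have hA2m1 : 1 / 2 ≤ A ^ (2 * m + 1) := by linarith
  have hu2ge : 1 / 8 ≤ u ^ 2 := by
    rw [hu2]
    calc (1 : ℝ) / 8 = 1 / 4 * (1 / 2) := by norm_num
      _ ≤ (N * B) * A ^ (2 * m + 1) := by
          rw [hNB]; exact mul_le_mul_of_nonneg_left hA2m1 (by norm_num)
      _ = N * (A * B) * A ^ (2 * m) := by ring
  -- apply the hypothesis at s = 3π²/L² to the symmetric product state
  set s : ℝ := 3 * Real.pi ^ 2 / L ^ 2 with hsdef
  have hspos : 0 < s := by positivity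
  have hs : 0 ≤ s := hspos.le
  have key := hG m hmN₀ L hL hdens e0 e0_ne_zero hwin s hs (symState m hL e0_ne_zero a b hab)
  unfold GDIneqPow at key
  have hE := periodicEnergy_symState (m := m) hL e0_ne_zero hab
  rw [nsq_e0, hb2] at hE
  rw [hE, norm_e0, one_pow, div_one] at key
  have hEnn : 0 ≤ N * (B * (4 * Real.pi ^ 2 * 1 / L ^ 2)) := by positivity
  have hpen : 0 ≤ C * s ^ p * L ^ 2 := by positivity
  have hreal : s * (2 * N * ‖sourceIntegral m L e0 (symFun m L e0 a b)‖) ≤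
      N * (B * (4 * Real.pi ^ 2 * 1 / L ^ 2)) + C * s ^ p * L ^ 2 := by
    have h0 := real_of_le_budget hEnn hpen key
    rw [hN'] at h0
    exact h0
  have hI : u ≤ N * ‖sourceIntegral m L e0 (symFun m L e0 a b)‖ := by
    rw [hudef]
    exact mul_le_mul_of_nonneg_left hsrc hNpos.le
  have h2 : s * (2 * u) ≤ N * (B * (4 * Real.pi ^ 2 * 1 / L ^ 2)) + C * s ^ p * L ^ 2 := by
    refine le_trans ?_ hreal
    have : 2 * u ≤ 2 * N * ‖sourceIntegral m L e0 (symFun m L e0 a b)‖ := by linarith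
    exact mul_le_mul_of_nonneg_left this hs
  have e3 : N * (B * (4 * Real.pi ^ 2 * 1 / L ^ 2)) = Real.pi ^ 2 / L ^ 2 := by
    calc N * (B * (4 * Real.pi ^ 2 * 1 / L ^ 2)) = (N * B) * (4 * Real.pi ^ 2 / L ^ 2) := by ring
      _ = Real.pi ^ 2 / L ^ 2 := by rw [hNB]; ring
  rw [e3] at h2
  -- the super-quadratic budget is ≤ π²/L² because L^q ≥ K + 1
  have hLqpos : 0 < L ^ q := Real.rpow_pos_of_pos hL q
  have hLqne : L ^ q ≠ 0 := hLqpos.ne'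
  have hmain : C * (3 * Real.pi ^ 2) ^ p ≤ Real.pi ^ 2 * L ^ q := by
    have h1 : K ≤ L ^ q := by linarith [hLq]
    rw [hKdef, div_le_iff₀ (by positivity)] at h1
    linarith [h1]
  have hsp : s ^ p = (3 * Real.pi ^ 2) ^ p / L ^ (2 * p) := by
    rw [hsdef, Real.div_rpow (by positivity) (by positivity)]
    congr 1
    rw [← Real.rpow_natCast L 2, ← Real.rpow_mul hL.le]
    norm_num
  have hL2p : L ^ (2 * p) = L ^ q * L ^ (4 : ℝ) := by
    rw [← Real.rpow_add hL]
    congr 1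
    rw [hqdef]
    ring
  have hL4 : L ^ (4 : ℝ) = L ^ (4 : ℕ) := by
    rw [show (4 : ℝ) = ((4 : ℕ) : ℝ) by norm_num, Real.rpow_natCast]
  have hbud : C * s ^ p * L ^ 2 ≤ Real.pi ^ 2 / L ^ 2 := by
    rw [hsp, hL2p, hL4]
    calc C * ((3 * Real.pi ^ 2) ^ p / (L ^ q * L ^ (4 : ℕ))) * L ^ 2
        = (C * (3 * Real.pi ^ 2) ^ p) / (L ^ q * L ^ 2) := by
          field_simp
      _ ≤ (Real.pi ^ 2 * L ^ q) / (L ^ q * L ^ 2) :=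
          div_le_div_of_nonneg_right hmain (by positivity)
      _ = Real.pi ^ 2 / L ^ 2 := by
          field_simp
  -- contradiction: 2su ≤ 2π²/L² but (2su)² ≥ s²/2 = 9π⁴/(2L⁴) > 4π⁴/L⁴
  have h3 : s * (2 * u) ≤ 2 * Real.pi ^ 2 / L ^ 2 := by
    have e : Real.pi ^ 2 / L ^ 2 + Real.pi ^ 2 / L ^ 2 = 2 * Real.pi ^ 2 / L ^ 2 := by ring
    linarith [h2, hbud]
  have h4 : (s * (2 * u)) ^ 2 ≤ (2 * Real.pi ^ 2 / L ^ 2) ^ 2 :=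
    pow_le_pow_left₀ (by positivity) h3 2
  have h5 : (s * (2 * u)) ^ 2 = 4 * s ^ 2 * u ^ 2 := by ring
  rw [h5] at h4
  have h6 : 4 * s ^ 2 * (1 / 8) ≤ 4 * s ^ 2 * u ^ 2 :=
    mul_le_mul_of_nonneg_left hu2ge (by positivity)
  have h9 := h6.trans h4
  have h7 : s ^ 2 = 9 * Real.pi ^ 4 / L ^ 4 := by
    rw [hsdef]
    field_simp
    ring
  have h8 : (2 * Real.pi ^ 2 / L ^ 2) ^ 2 = 4 * (Real.pi ^ 4 / L ^ 4) := by
    field_simp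
    ring
  rw [h7, h8] at h9
  have e9 : 4 * (9 * Real.pi ^ 4 / L ^ 4) * (1 / 8) = 9 / 2 * (Real.pi ^ 4 / L ^ 4) := by ring
  rw [e9] at h9
  have hX : 0 < Real.pi ^ 4 / L ^ 4 := by positivity
  linarith

end Superquadratic

/-! ## §C The density threshold: fixed-density versions (monotonicity proved; falsity CONJECTURAL) -/

section Density

/-- `GDCanWith` is antitone in the density threshold: a smaller `ρ₀` admits fewer `(N, L)`. [folklore] -/
theorem GDCanWith.mono_rho {ρ₀ ρ₁ C : ℝ} {N₀ : ℕ} {v : ℝ → ℝ≥0∞} {M : ℝ} (h01 : ρ₁ ≤ ρ₀)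
    (h : GDCanWith ρ₀ C N₀ v M) : GDCanWith ρ₁ C N₀ v M :=
  fun m hm L hL hd n hn hw s hs Φ =>
    h m hm L hL (hd.trans (mul_le_mul_of_nonneg_right h01 (by positivity))) n hn hw s hs Φ

/-- The crux at a FIXED density scale `ρ₁` (the defender may no longer shrink the density after seeing
`v` and `M`; everything else verbatim, in `GDCanWith` form). -/
def GaussianDominationCanAtDensity (ρ₁ : ℝ) : Prop :=
  ∀ v : ℝ → ℝ≥0∞, IsRepulsiveFiniteRange v → ∀ M : ℝ, 0 < M →
    ∃ C : ℝ, 0 < C ∧ ∃ N₀ : ℕ, GDCanWith ρ₁ C N₀ v M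

/-- A fixed positive density scale that works for every `v, M` gives the crux (in `GDCanWith` form; the
converse direction is where the content is). [folklore] -/
theorem gdCanWith_of_atDensity {ρ₁ : ℝ} (hρ₁ : 0 < ρ₁) (h : GaussianDominationCanAtDensity ρ₁) :
    ∀ v : ℝ → ℝ≥0∞, IsRepulsiveFiniteRange v → ∀ M : ℝ, 0 < M →
      ∃ ρ₀ C : ℝ, 0 < ρ₀ ∧ 0 < C ∧ ∃ N₀ : ℕ, GDCanWith ρ₀ C N₀ v M :=
  fun v hv M hM => by
    obtain ⟨C, hC, N₀, hG⟩ := h v hv M hM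
    exact ⟨ρ₁, C, hρ₁, hC, N₀, hG⟩

/-- **CONJECTURAL NEAR-MISS (not proved; recorded for the provers): diluteness is load-bearing in
substance, not only through `kR₀ ≪ 1`.**  Claim: `¬ GaussianDominationCanAtDensity 1`, i.e. at a fixed
density scale the statement fails for SOME admissible `v`.  Mechanism (physics, no rigorous proof exists):
take `v` = hard spheres of diameter `d` with `ρd³ = 1·d³` past the freezing density (`ρd³ ≳ 0.25`, GFMC
Kalos–Levesque–Verlet, Phys. Rev. A 9 (1974) 2178) but below close packing (so `E₀ < ⊤` and nothing is
vacuous), or a bounded soft core `h·1_{[0,R₀]}` in the cluster-crystal regime (negative `v̂(k₀)`,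
`k₀R₀ ≈ 5.8`; variational/QMC freezing of soft-core bosons at `T = 0`: Prestipino–Sergi–Bruno
doi:10.1103/physrevb.98.104104, Ancilotto–Rossi–Toigo doi:10.1103/physreva.88.033618,
Macrì–Maucher–Cinti–Pohl doi:10.1103/physreva.87.061602).  The ground state is then (believed) crystalline with reciprocal
vector `G`; in finite volume the translation-symmetric ground state carries an Anderson tower of momentum
`G` states at excitation energy `∼ G²/N`, connected to `Ψ₀` by `Λ_G†` with matrix element `∼ √N·c_G`
(the condensate orbital is modulated), so `|⟨Ψ₁, Λ_G†Ψ₀⟩|²/(E₁ − E₀) ∼ N²c_G²/G²` — unbounded in `N`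
against any `4π²C/G²`; `G` lies in the window once `M ≥ G` (`M` is universally quantified) and `n = GL/2π`
is integral along a subsequence of commensurate boxes.  OBSTRUCTION to a Lean proof: no crystallisation /
tower-of-states theorem for any continuum `v` (this is the Crystallization conjunct's territory); even
`E₀` of the dense hard-sphere system has no closed form.  CONSEQUENCE for provers: a proof of the crux must
use `ρ₀ = ρ₀(v, M) → 0` to exclude ordered competitors, i.e. genuinely dilute-gas input (`ρa³ → 0`), not
merely the kinematic window condition. -/
theorem conjecture_gdCan_false_at_fixed_density : ¬ GaussianDominationCanAtDensity 1 := by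
  sorry

end Density

/-! ## §D Targets — the registered stubs of the three lines, read against this file

No stub of any line is refuted by a landed Negative lemma or by anything in this file.  Status per stub
(refuter reading, gen3; "theorem" = provable as stated by known mathematics, "crux-strength" = carries the
open `T = 0` phase-stiffness content):

**Skeleton `Lines/ward-chord-splitting.lean`** (registered 2026-08-16T02:58Z; stubs S1–S4).
* S1 `stub_wardChord : WardChord` — THEOREM (identity level).  `E(e^{-itF}Φ) = E(Φ) − 2t∫∇f·j_Φ + t²∫|∇f|²n_Φ`,
  `f = sin(k·x+θ)`, `t = ±s`.  Checked corner cases: `N = 0` (`Config 0` is a point, `cellN 0 L = univ`,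
  `Measure.pi` over `Fin 0` is a Dirac mass, so trial states EXIST for every `L`, `phasedCurrent = 0`,
  `E₀ = E = 0`: the chord reads `0 ≤ 0`); `E₀ = ⊤` (then `E(Φ) = ⊤`, trivial); `n = 0` (`kvec = 0`).  Not a
  target.
* S2 `stub_weakDensityChord : WeakDensityChord` — crux-strength (density channel), weaker than the route's
  `DensityResponse` by `k²/(k²+ρa)`.  Free gas: optimal constant between `1/2` (product states
  `(1+ε sin)^{⊗N}`: `D ≈ Nε`, `E ≈ Nε²k²/2`) and `1` (one-body bound `|∫sin(k·x)|φ|²| ≤ (2/k)‖φ‖‖∇φ‖`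
  summed with Cauchy–Schwarz: `D² ≤ 4NT/k²`).  Interacting: Bogoliubov `χ_ρρ/N = 2/(k²+16πρa) ≤ 2/k²`, margin
  → ∞ in the phonon regime.  Would break only with anomalously soft density modes (none for dilute
  repulsive `v`); at FIXED density it breaks with §C's crystal (`χ_ρρ(G) ∼ N²`).
* S3 `stub_backflowChord : BackflowChord` — crux-strength; by the planner's own `cnumberGD_of` /
  `backflowChord_of_cnumberGD` it is EQUIVALENT to `CNumberGD` modulo S1 ∧ S2.  Free gas: holds with
  `C = 1/4` for ALL states (kinematics: `|R| ≤ Σ_{p≠0,-k}|k||p+k|√(n_{p+k}n_p) ≤ |k|√T√(N−n₀)`, so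
  `|R|² ≤ k²T(N−n₀) ≤ k²NT`).  Bogoliubov: the one-phonon matrix element of `R` is
  `½√(k²/e_k)(e_k+k²)(√N − √N₀)`, i.e. `(1−√x)²`-suppressed in `|·|²`, contributing `χ_R ≈ ½Nk²(1−√x)²` —
  INSIDE the budget `∼ CNk²` even at large depletion; two-phonon part `O(√(ρa³))` of the budget.  No lever
  for a refutation short of `ρ_s → 0`.
* S4 `stub_normalisationLift : CNumberGD → crux` — an implication between two open statements; refutable
  only by proving `CNumberGD` (crux-strength itself) and killing the crux.  Content = Josephson factor
  `χ(Λ) ≈ χ(X)/(Nx)`, `x = n₀/N`: BEC-strength on uncondensed near-minimisers, as the planner says.  Not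
  attackable; note for the lead: for the free gas BOTH sides hold sharply (`CNumberGD` with `C = 1/(16π²)`:
  `|⟨a_k†a_0⟩|² ≤ n_kn₀ ≤ NT/k²`, tight on the same product states as `free_const_ge`).

**`Lines/coupling-monotone-chord.lean`** (stubs A–D; composes to the crux with the SHARP constant
`C = 1/(4π²)` for every `v`).
* A `stub_freeAnchor` — THEOREM (the free ladder: `H_s` preserves the occupations of modes `∉ {0,k}`; in
  each block `Λ†` is the truncated `b†`, `k²b†b − s(b+b†) ≥ −s²/k²`, compression preserves the bound; sup
  norm only weakens).  Tight by `free_const_ge`.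
* B `stub_sourceRaisesInteraction` — THE BET, an EXACT sign for every finite admissible `(N, L)`:
  `⟨W⟩_{sourced} ≥ ⟨W⟩_{unsourced}`.  First order in `w`: Hartree sign `ŵ_per(k) > 0`, true in the window
  (`kR₀ ≤ M√ρ₀R₀ < π`), FALSE outside it where `ŵ(k) < 0` (triage j005099; ED toy of this seat, job
  j011503/successor: `r = χ_Λε_k/2 > 1` exactly where `Ṽ(k) < 0`) — so the window is load-bearing for B
  and for the sharp constant (Bogoliubov: `χ/2 = (k²+ρŵ_k)/(k²(k²+2ρŵ_k)) > 1/k²` iff `ŵ_k < 0`).  Second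
  order: `∂_gχ = −k²/(k²(k²+2g)²)·… < 0`, consistent.  Large `s`: the sourced ground state is a two-mode
  state with `W(∞) = (ŵ(0)N(N−1) + 2ŵ(k)n₀n_k)/2L³ ≥ W_Hartree ≥ W(0)`, consistent.  Risk: it is an exact
  inequality for FINITE systems with `1/N` corrections of unknown sign where the Bogoliubov margin
  `8πρa/(k²+16πρa)` is small (upper window, weak coupling) — "zero slack" (planner).  Not refutable here
  (needs certified many-body numerics in 3-D continuum).
* C `stub_chordTransport` — THEOREM (variational Hellmann–Feynman: `e(τ,s) = inf_Φ[T + τW − sJ]` is concave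
  and finite for bounded `w`, continuous at `τ = 0⁺` (`limsup ≤` by fixing `Φ`, `liminf ≥` by concavity),
  right slope `= lim_{δ↓0} inf_{δ-near-min} W` (both inequalities elementary), `D = e(·,s) − e(·,0)`
  locally Lipschitz on `(0,1]`, `D(1) − D(0⁺) = ∫∂⁺D ≥ 0`).
* D `stub_truncationLimit` and **`Lines/raman-chord-regimes.lean` `stub_truncatedEnergy`** — THEOREMS, but
  note the real content: `lim_h E₀(min(v,h)) = inf{T(Φ) : Φ ∈ H¹, Φ = 0 a.e. on the core set K}` (Rellich +
  weak lower semicontinuity), while `E₀(v)` is the infimum over `C¹` states vanishing on `supp(1_K dX)`;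
  equality needs (i) radiality of `v` (a.e.-vanishing on `{r ∈ S}` forces q.e.-vanishing on
  `{r ∈ supp 1_S}` along a.e. radial line) and (ii) Hedberg's theorem `H¹₀(Ω) = {u ∈ H¹ : u = 0 q.e. off Ω}`
  for ARBITRARY open `Ω` (Hedberg, Acta Math. 147 (1981), doi:10.1007/bf02392874; Adams–Hedberg,
  Function Spaces and Potential Theory, Thm 9.1.3) — no regularity of the core set is needed, so exotic
  admissible `v` (`⊤` on fat Cantor sets of radii, accumulating shells) do NOT produce a gap.  Checked on
  paper: thin (`dr`-null) hard shells are invisible to BOTH sides (the `lintegral` ignores `⊤` on null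
  sets), caged sectors of shell potentials cost `≥ 2π²/R₀²` per bound pair `≫ 8πaρ`, so at low density the
  unbound sector carries `E₀`.  Not targets.
* raman `stub_freeChord` = A above; `stub_coreChord` / `stub_healingChord` — crux-strength, uniformly over
  truncations `h` (physically monotone in `h`; no lever).  Formal check: `∫ min(v,h) ≤ h·|B_{R₀}| < ⊤` and
  `E₀(v_h) < ⊤` for bounded `v_h`, so the `toReal`s in the regime conditions are honest; for `v = 0` both
  regime bounds force `s = 0` (trivial).

If the lead's HANDOFF lists a STUCK stub, this section becomes `theorem <stub>_false : ¬ … ` attempts.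
-/

/-! ## §E Kill record — why `GaussianDominationCan` resists (gen1–gen3)

Square form: `|⟨Φ,Λ_k†Φ⟩|² ≤ (4π²C/k∞²)(E_v(Φ) − E₀)`, `Λ_k† = a_k†a_0n̂₀^{-1/2}` (`= U_N^* b_k^† U_N`, LNSS),
`Θ = P₀n̂₀^{-1/2}Φ`, `2(m+1)⟨Φ, e^{ik·x₀}Θ⟩ = 2⟨Φ,Λ_k†Φ⟩` by Bose symmetry.  Equivalently
`E₀(H − s(e^{iθ}Λ_k† + h.c.)) ≥ E₀ − 4π²C s²/k∞²` for all `s ≥ 0`, `θ`.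

1. FORMAL READ-BACK (gen1, re-done gen3): every Bochner integral (`P_i`, `Q_S`, `Θ`, source) is of a
   continuous function on a bounded cell — no junk zero; non-integrability could only LOWER the left side.
   `‖n‖` is the SUP norm (`k∞ ≤ |k| ≤ √3k∞`): constants only.  `E(Φ) = ⊤` or `E₀ = ⊤` make the inequality
   trivial (so jammed hard cores, over-ranged potentials etc. are VACUOUSLY fine — ENNReal turns every
   "too dense / infinite energy" attack into truth).  `IsRepulsiveFiniteRange` admits `v = 0`, hard cores,
   `⊤` on any measurable set of radii, unbounded non-integrable profiles; `v` matters only up to `dr`-null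
   sets.  Quantifier order `∀v ∀M ∃ρ₀ C N₀` lets the defender go dilute AFTER seeing `v, M`.
2. FREE GAS `v = 0`: holds with `C = 1/4π²` for ALL `N, L, n` (ladder/displaced truncated oscillator), and
   this constant is forced (`free_const_ge`); shape `s²` forced (§B).
3. BOGOLIUBOV, all `k`: second-order shift `−s²(u_k²+v_k²)/e_k` (running wave: `k` and `−k` channels do not
   interfere, every `θ`), `(u²+v²)/e_k = (k²+8πρa)/(k²(k²+16πρa)) < 1/k²`; phase-quadrature worst case
   `(u+v)²/e_k = 1/k²`.  With the true `ŵ(k)`: `> 1/k²` iff `ŵ(k) < 0`, impossible in the window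
   (`kR₀ ≪ 1`).  So `C·4π² = 1 + o(1)` is consistent everywhere in the admissible region.
4. TOP CORNER `L = M²N/4π²` (gen2 `corner`): `ρ ∝ N⁻²`, GP parameter `Na/L = 4π²a/M²` FIXED, `kξ` fixed —
   Gross–Pitaevskii scaling on the unit torus, where Bogoliubov theory is a theorem (BBCS 2018–19): the
   crux there is essentially provable; no counterexample can live at the corner.
5. THERMODYNAMIC CORNER `ρ = ρ₀`, `N → ∞`, `k → 2π/L`: Josephson/Gavoret–Nozières: `k²χ_Λ/2 → n₀/(2ρ_s)`
   (our normalisation; free-like regime `kξ ≫ 1` gives `1`) [Gavoret–Nozières, Ann. Phys. 28 (1964) 349;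
   Josephson, Phys. Lett. 21 (1966) 608; Dawson–Mihaila–Cooper doi:10.1103/physreva.86.013603
   (Josephson relation ⇔ Goldstone theorem); no fragmentation for dilute repulsive gases: Ho–Baym
   arXiv:cond-mat/9811275].  A counterexample needs `ρ_s/ρ → 0` or soft
   phase modes at `T = 0` for a translation-invariant dilute repulsive Bose gas — contradicts universal
   dilute-gas physics; no candidate `v` exists (disorder and lattices are excluded by the types; 1-D/2-D
   excluded by `Fin 3`).
6. EXOTIC ADMISSIBLE `v` (gen2 hard shells; gen3 fat-Cantor radii, accumulating shells, huge-but-finite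
   barriers): configuration space disconnects into caged sectors, each costing `≥ 2π²/R₀²` per caged pair;
   at `ρ ≤ ρ₀(v)` the uncaged hard-sphere-like sector carries `E₀` and the gas is an ordinary dilute gas of
   scattering length `≤ R₀`.  No pathology survives `ρ₀ → 0`.
7. HYPOTHESIS MUTATION: `N₀` redundant; `n ≠ 0`, Bose symmetry load-bearing (gen2); guards decorative;
   `C ≥ 1/4π²` and `p = 2` forced (gen2, §B); window upper edge: NOT load-bearing for truth as far as anyone
   can compute (free/Bogoliubov fine at all `k`; needed by METHODS and by the sharp-constant line B);
   density threshold: load-bearing in substance (§C, conjectural); dropping finite range only adds vacuous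
   cases (`v ≡ c > 0` ⇒ `v_per = ⊤`).
8. SUM RULES cannot kill it: the Bogoliubov/uncertainty LOWER bound `χ_Λ/2 ≥ (2n_k+1)²/m₁`,
   `m₁ = ½⟨[[X,H],X]⟩ = k²·1_{n₀≥1} + (interaction part ≈ 8πρa)`, is saturated by Bogoliubov and stays
   `≤ 1/k²`.
9. LITERATURE: continuum `T = 0` Gaussian domination is in print only via reflection positivity (lattice,
   half filling: KLS 1988, in tree `kls_xy_gaussianDomination_ground_holds`); no printed counterexample
   family; barrier catalogue (HalfFillingReflectionPositivity, KineticGapLengthScales,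
   BogoliubovPerturbationInfrared, EnergyAsymptoticsWithoutCondensation, PitaevskiiStringariOneDimension,
   CasimirBox, SymmetryBreakingWithoutCondensate) — none bites the statement (they constrain METHODS).
10. ED TOY (this seat, 1-D ring, exact LNSS source, kit job id in NOTES/evidence): `r = χ_Λε_k/2` and the
   chord constant stay `≤ 1` for on-site/positive-`Ṽ` interactions at all fillings tested and exceed `1`
   exactly where `Ṽ(k) < 0`; the stub-B sign `⟨W⟩_s − ⟨W⟩_0 ≥ 0` likewise.  (Numbers in the evidence note.)

11. THE NON-LINEAR GAP `k²√N ≪ s ≪ k√(aρN)` (deep window `k ≪ √(ρa)`; = raman's "core" regime, below the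
   free anchor and beyond Bogoliubov's small-displacement validity): the optimal response to the running-wave
   source is a PHASE-modulated condensate `φ = exp(iε sin(k·x+θ))` — no density modulation, no interaction
   cost, kinetic cost `Nk²ε²/2`, coherence `|φ̂_kφ̂₀| = |J₁(ε)J₀(ε)| ≤ 0.34` — giving energy drop `≈ s²/(2k²)`
   up to `ε ∼ 1` (`s ∼ k²√N`) and at most linear growth `≤ 2s·0.6√N` beyond, against a quadratic budget: the
   chord constant equals the curvature constant up to `O(1)`; density-modulated (two-mode, real `α, β`)
   responses are stiffer, `1/(k²+8πρa)`.  So the chord-vs-curvature distinction (raman card) is not a lever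
   either.

WHAT A DISPROOF WOULD NEED: an admissible `v` and a density sequence `ρ → 0` along which the dilute Bose
gas has a non-superfluid or modulated ground state — i.e. a counterexample to `T = 0` superfluidity of the
dilute repulsive Bose gas.  None is conjectured anywhere.  Expected verdict: TRUE, open-problem difficulty.
-/

end Summit.AtomisticToContinuum.BoseEinsteinCondensation.Cruxes.GaussianDominationCan.Disproof

end
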